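import Summits.BirchSwinnertonDyer.Rank1Residual.X4.OldEigenPairOfIhara
import Literature.NumberTheory.EllipticCurves.ModularSymbolsManinDrinfeldGeneralProofs
import HarnessLib

/-!
# From an `ℓ`-old decomposition ON CYCLES to the level-lowering certificate ON PATHS (cell `b2b-bsdres`, seat additive-p4, line V45)

HONEST FRAMING (verbatim, cell `b2b-bsdres`): the goal of the cell is to DELETE the COMBINATION-SHAPED
residual classes for ALL analytic-rank `≤ 1` curves over `ℚ` — "full BSD formula for every rank `≤ 1`
curve in class `C`" assembled STRICTLY from published theorems — so that the rank-`≤ 1` remainder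
becomes exactly the CONSTRUCTION-SHAPED classes, which are TYPED (missing-input Props), NOT attempted;
this is not "finishing BSD". This file: TOOL theorems (modular symbols / period homology), 0 defs,
0 facts, nothing booked; X4 CONSTRUCTION-SHAPED.

## What is proved (the assembly of line V45)

`exists_sub_mul_of_oldOnCycles_of_ribet1984_iharaLemma` — THE MAZUR-PRINCIPLE ROUTE WITHOUT
MULTIPLICITY ONE, kernel side. Data: `ℓ ∤ M` prime, an odd prime `p`, integer eigenvalues `θ`
(`θ(ℓ)² = 1`), a function `Ψ : S₂(Γ₀(Mℓ))^∨ → 𝔽_p` additive on a subgroup `P ⊇ H₁(X₀(Mℓ), ℤ)`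
containing the symbol functionals `{∞, r}` and `T_q`-stable, `T_q`-eigen there with eigenvalues
`θ(q)` (every prime `q`), carrying `φ : ℚ → 𝔽_p` on paths (`Ψ({∞, r}) = φ(r)`) — for a rational
newform `f` this is `X4/PlusFunctionalModP.exists_plusFunctional` with `φ = [·]⁺_f mod p`; ONE prime
`q₀ ≡ 1 (mod Mℓ)` with `θ(q₀) ≢ q₀ + 1 (mod p)` (non-Eisenstein numeral); and the HYPOTHESIS
(★★) "`Ψ` is `ℓ`-OLD ON CYCLES": `Ψ = Λ₁∘α_* + Λ₂∘β_*` on `H₁(X₀(Mℓ), ℤ)` for two additive `𝔽_p`-valued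
`Λ₁, Λ₂` on `H₁(X₀(M), ℤ)` (the cohomological form of `E'[p] ⊆ B_ℓ`, Mazur's principle). Conclusion:
there is a `1`-periodic `μ : ℚ → 𝔽_p`, `T_q`-eigen with eigenvalue `θ(q)` at every prime `q ∤ Mℓ`,
with `φ(r) = μ(r) − θ(ℓ) μ(ℓ r)` for ALL `r ∈ ℚ` — the level-lowering certificate
`PlusSymbolLevelLowersAt` of gen 20 (for `θ(ℓ) = a_ℓ = 1`). PROOF: the dichotomy of
`X4/LevelLoweringCharacter` — either `Ψ = 0` on cycles (then `φ = 0` on paths by closing the path at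
`q₀`, `μ = 0`), or `θ̄` is a character `χ` of the level-`M` Hecke ring; then the Fitting projection
(`X4/OldEigenPairOfIhara`, Ihara BY NAME) makes `Λ₁, Λ₂` `χ`-eigen, `X4/OldShapeOfIhara` forces the
`ℓ`-stabilised shape `Ψ = Λ₁∘α_* − θ(ℓ)Λ₁∘β_*` with `Λ₁` eigen, and CLOSING THE PATH at `q₀` (Manin;
the tree's `dualMap_heckeT_sub_smul_mem_periodHomology`: `(T_{q₀} − q₀ − 1){∞, r} ∈ H₁`) defines
`μ(r) = (θ(q₀) − q₀ − 1)⁻¹ Λ₁((T_{q₀} − q₀ − 1){∞, r})`, periodic and Hecke-eigen, and transports the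
identity from cycles to paths (`α_*{∞, r} = {∞, r}`, `β_*{∞, r} = {∞, ℓ r}`).

## References

* K. A. Ribet, Proc. ICM 1983 (1984), Thm. 4.1 (Ihara's lemma). [cite: Ribet1984ICM, Thm. 4.1]
* K. Ribet, W. Stein, *Lectures on Serre's conjectures* (2001), Thm. 3.14 (Mazur's principle). [cite: RibetStein2001, Thm. 3.14 and Lemma 3.17]
* Ju. I. Manin, Izv. Akad. Nauk SSSR 36 (1972), Thm. 3.3 (20), Thm. 3.5 (22) (closing the path). [cite: Manin1972, Thm. 3.3 (20) and Thm. 3.5 (22)]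
* J. E. Cremona, *Algorithms for modular elliptic curves* (1997), §2.4. [cite: CremonaAlgorithms1997, §2.4 (2.4.1)–(2.4.2)]
* B. Mazur, J. Tate, J. Teitelbaum, Invent. Math. 84 (1986), §I.4 (4.2). [cite: MazurTateTeitelbaum1986Invent, §I.4 (4.2)]
-/

noncomputable section

open scoped MatrixGroups ModularForm

open CongruenceSubgroup Finset Matrix

open Literature.NumberTheory.EllipticCurves Literature.NumberTheory.EllipticCurves.ModularForms
  Literature.NumberTheory.EllipticCurves.ModularForms.HidaCohomology

namespace Summit.BirchSwinnertonDyer.Rank1Residual.LevelLowering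

/-! ### §1 Additive functions on a subgroup of the dual space -/

section AdditiveOn

variable {k : Type*} [CommRing k] {N : ℕ}
  {P : AddSubgroup (Module.Dual ℂ (CuspForm (Gamma0 N) 2))} (Φ : Module.Dual ℂ (CuspForm (Gamma0 N) 2) → k)
  (hadd : ∀ x ∈ P, ∀ y ∈ P, Φ (x + y) = Φ x + Φ y)

include hadd

/-- An additive function on a subgroup is subtractive there. [folklore] -/
theorem apply_sub_of_additiveOn {x y : Module.Dual ℂ (CuspForm (Gamma0 N) 2)} (hx : x ∈ P) (hy : y ∈ P) :
    Φ (x - y) = Φ x - Φ y := by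
  have h := hadd (x - y) (P.sub_mem hx hy) y hy
  rw [sub_add_cancel] at h
  linear_combination -h

/-- An additive function on a subgroup is `ℕ`-homogeneous there: `Φ((n : ℂ) • x) = n Φ(x)`. [folklore] -/
theorem apply_natCast_smul_of_additiveOn {x : Module.Dual ℂ (CuspForm (Gamma0 N) 2)} (hx : x ∈ P) (n : ℕ) :
    Φ ((n : ℂ) • x) = n * Φ x := by
  induction n with
  | zero =>
    have h := hadd 0 P.zero_mem 0 P.zero_mem
    rw [add_zero] at h
    rw [Nat.cast_zero, zero_smul, Nat.cast_zero, zero_mul]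
    linear_combination -h
  | succ n ih =>
    have hnx : ((n : ℂ) • x) ∈ P := by rw [Nat.cast_smul_eq_nsmul]; exact P.nsmul_mem hx n
    rw [Nat.cast_succ, add_smul, one_smul, hadd _ hnx _ hx, ih, Nat.cast_succ]
    ring

/-- An additive function on a subgroup is additive over finite sums there. [folklore] -/
theorem apply_sum_of_additiveOn {ι : Type*} (s : Finset ι) (g : ι → Module.Dual ℂ (CuspForm (Gamma0 N) 2))
    (hg : ∀ i ∈ s, g i ∈ P) : Φ (∑ i ∈ s, g i) = ∑ i ∈ s, Φ (g i) := by
  classical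
  induction s using Finset.induction_on with
  | empty =>
    have h := hadd 0 P.zero_mem 0 P.zero_mem
    rw [add_zero] at h
    rw [Finset.sum_empty, Finset.sum_empty]
    linear_combination -h
  | @insert a s has ih =>
    have hs : ∀ i ∈ s, g i ∈ P := fun i hi ↦ hg i (Finset.mem_insert_of_mem hi)
    rw [Finset.sum_insert has, Finset.sum_insert has,
      hadd _ (hg a (Finset.mem_insert_self a s)) _ (P.sum_mem hs), ih hs]

end AdditiveOn

/-! ### §2 Symbol functionals under the degeneracy maps and the Hecke ring -/

section Symbols

variable {M N d : ℕ} [NeZero M] [NeZero N] [NeZero d]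

/-- **`α_{d,*}{∞, r}_N = {∞, d r}_M`** for the symbol functionals `σ_N r : h ↦ {∞, r}_h` (Cremona
1997, §2.4, (2.4.1)–(2.4.2): `{∞, r}_{f ∣ diag(d,1)} = {∞, d r}_f`; Darmon–Diamond–Taylor Lemma 4.28:
`α : τ ↦ τ`, `β : τ ↦ ℓτ`). [cite: CremonaAlgorithms1997, §2.4 (2.4.1)–(2.4.2)] -/
theorem dualMap_degeneracyMap0_symbol (h : M * d ∣ N)
    (σN : ℚ → Module.Dual ℂ (CuspForm (Gamma0 N) 2))
    (hσN : ∀ (r : ℚ) (f : CuspForm (Gamma0 N) 2), σN r f = modularSymbol f r)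
    (σM : ℚ → Module.Dual ℂ (CuspForm (Gamma0 M) 2))
    (hσM : ∀ (r : ℚ) (f : CuspForm (Gamma0 M) 2), σM r f = modularSymbol f r) (r : ℚ) :
    (degeneracyMap0 M N d 2).dualMap (σN r) = σM (d * r) := by
  ext f
  rw [LinearMap.dualMap_apply, hσN, hσM, ← modularSymbol_slash_tpD d f, modularSymbol,
    coe_degeneracyMap0 M N d 2 h f]

/-- `T_q^∨ z = T_q • z` (the `𝕋_ℤ`-action on `S₂^∨` is by transposition). [folklore] -/
theorem dualMap_heckeT_eq_T_smul {q : ℕ} [NeZero q] (hq : q.Prime)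
    (z : Module.Dual ℂ (CuspForm (Gamma0 N) 2)) :
    (heckeT (Gamma0 N) 2 q).dualMap z = HeckeRing0.T N 2 q hq • z := by
  ext g
  simp [HeckeRing0.smul_dual_apply, HeckeRing0.toEnd_T]

variable (N) in
/-- **Closing the path** in `𝕋_ℤ`-module form: for a prime `q₀ ≡ 1 (mod N)` and every `r ∈ ℚ`,
`T_{q₀} • {∞, r} − (q₀ + 1) • {∞, r} ∈ H₁(X₀(N), ℤ)` (Manin 1972 Thm. 3.3 (20); the tree's
`dualMap_heckeT_sub_smul_mem_periodHomology`). [cite: Manin1972, Thm. 3.3 (20) and Thm. 3.5 (22)] -/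
theorem T_smul_sub_smul_symbol_mem_periodHomology (σ : ℚ → Module.Dual ℂ (CuspForm (Gamma0 N) 2))
    (hσ : ∀ (r : ℚ) (f : CuspForm (Gamma0 N) 2), σ r f = modularSymbol f r)
    {q₀ : ℕ} (hq₀ : q₀.Prime) (hq₀1 : q₀ ≡ 1 [MOD N]) (r : ℚ) :
    HeckeRing0.T N 2 q₀ hq₀ • σ r - ((q₀ + 1 : ℕ) : ℂ) • σ r ∈ periodHomology N := by
  haveI : NeZero q₀ := ⟨hq₀.ne_zero⟩
  have hq₀N : ¬ q₀ ∣ N := by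
    intro hd
    have h01 : 1 ≡ 0 [MOD q₀] :=
      (hq₀1.of_dvd hd).symm.trans (Nat.modEq_zero_iff_dvd.mpr (dvd_refl q₀))
    exact hq₀.one_lt.ne' (Nat.dvd_one.mp (Nat.modEq_zero_iff_dvd.mp h01))
  have h1 : (q₀ : ZMod N) = 1 := by
    have := (ZMod.natCast_eq_natCast_iff' q₀ 1 N).mpr hq₀1
    rwa [Nat.cast_one] at this
  have h := dualMap_heckeT_sub_smul_mem_periodHomology N σ hσ hq₀ h1 hq₀N r
  rw [Nat.cast_add, Nat.cast_one]
  rwa [dualMap_heckeT_eq_T_smul hq₀] at h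

end Symbols

/-! ### §3 The level-`M` function `μ` carried by an eigen-functional `Λ` on `H₁(X₀(M), ℤ)` -/

section Mu

variable {k : Type*} [Field k] {M : ℕ} [NeZero M] {ℓ : ℕ}

/-- **The path function of an eigen-functional.** Let `Λ` be `k`-valued, additive on `H₁(X₀(M), ℤ)`
and `𝕋̃`-eigen there with character `χ`; let `q₀ ≡ 1 (mod M)` be prime and `c ∈ k`. Then
`μ(r) := c · Λ(T_{q₀}{∞, r} − (q₀+1){∞, r})` is `1`-periodic and satisfies the weight-`2` Hecke
relation `∑_j μ((r+j)/q) + μ(q r) = χ(T_q) μ(r)` at every prime `q ∤ Mℓ`, `q ∤ M` (Manin's closing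
of the path commutes with `T_q`; MTT §I.4 (4.2)). [cite: Manin1972, Thm. 3.3 (20) and Thm. 3.5 (22)]
[cite: MazurTateTeitelbaum1986Invent, §I.4 (4.2)] -/
theorem isPeriodic_and_heckeRel_of_eigen (Λ : Module.Dual ℂ (CuspForm (Gamma0 M) 2) → k)
    (χ : HeckeRing0.primeTo M 2 (M * ℓ) →+* k)
    (hadd : ∀ x ∈ periodHomology M, ∀ y ∈ periodHomology M, Λ (x + y) = Λ x + Λ y)
    (hΛ : ∀ (s : HeckeRing0.primeTo M 2 (M * ℓ)), ∀ x ∈ periodHomology M,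
      Λ ((s : HeckeRing0 M 2) • x) = χ s * Λ x)
    (σ : ℚ → Module.Dual ℂ (CuspForm (Gamma0 M) 2))
    (hσ : ∀ (r : ℚ) (f : CuspForm (Gamma0 M) 2), σ r f = modularSymbol f r)
    {q₀ : ℕ} (hq₀ : q₀.Prime) (hq₀1 : q₀ ≡ 1 [MOD M]) (c : k) (μ : ℚ → k)
    (hμ : ∀ r, μ r = c * Λ (HeckeRing0.T M 2 q₀ hq₀ • σ r - ((q₀ + 1 : ℕ) : ℂ) • σ r)) :
    IsPeriodic μ ∧ ∀ (q : ℕ) (hq : q.Prime) (hqS : ¬ q ∣ M * ℓ), ¬ q ∣ M →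
      HeckeRel μ q (χ (HeckeRing0.primeTo.T M 2 (M * ℓ) hq hqS)) := by
  have hmem : ∀ r, HeckeRing0.T M 2 q₀ hq₀ • σ r - ((q₀ + 1 : ℕ) : ℂ) • σ r ∈ periodHomology M :=
    T_smul_sub_smul_symbol_mem_periodHomology M σ hσ hq₀ hq₀1
  refine ⟨fun r z ↦ by rw [hμ, hμ, symbol_add_intCast M σ hσ r z], fun q hq hqS hqM r ↦ ?_⟩
  haveI : NeZero q := ⟨hq.ne_zero⟩
  -- the closing operator `A y = T_{q₀} • y − (q₀+1) • y` commutes with `T_q`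
  have hA : ∀ y : Module.Dual ℂ (CuspForm (Gamma0 M) 2),
      HeckeRing0.T M 2 q₀ hq₀ • (HeckeRing0.T M 2 q hq • y) - ((q₀ + 1 : ℕ) : ℂ) • (HeckeRing0.T M 2 q hq • y) =
        HeckeRing0.T M 2 q hq • (HeckeRing0.T M 2 q₀ hq₀ • y - ((q₀ + 1 : ℕ) : ℂ) • y) := by
    intro y
    rw [smul_sub, smul_smul, smul_smul, mul_comm, Nat.cast_smul_eq_nsmul, Nat.cast_smul_eq_nsmul,
      smul_comm]
  -- `∑_j σ((r+j)/q) + σ(q r) = T_q • σ r`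
  have hsum : ∑ j ∈ Finset.range q, σ ((r + j) / q) + σ (q * r) = HeckeRing0.T M 2 q hq • σ r := by
    rw [← dualMap_heckeT_eq_T_smul hq, dualMap_heckeT_eq_sum M σ hσ hq hqM r,
      ← Fin.sum_univ_eq_sum_range (fun j ↦ σ ((r + j) / q)) q]
    push_cast
    rfl
  -- compute
  simp only [hμ]
  rw [← Finset.mul_sum, ← mul_add, ← apply_sum_of_additiveOn Λ hadd _ _ (fun j _ ↦ hmem _),
    ← hadd _ ((periodHomology M).sum_mem fun j _ ↦ hmem _) _ (hmem _)]
  have e : ∑ j ∈ Finset.range q, (HeckeRing0.T M 2 q₀ hq₀ • σ ((r + j) / q) -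
      ((q₀ + 1 : ℕ) : ℂ) • σ ((r + j) / q)) +
      (HeckeRing0.T M 2 q₀ hq₀ • σ (q * r) - ((q₀ + 1 : ℕ) : ℂ) • σ (q * r)) =
      HeckeRing0.T M 2 q hq • (HeckeRing0.T M 2 q₀ hq₀ • σ r - ((q₀ + 1 : ℕ) : ℂ) • σ r) := by
    rw [← hA, ← hsum, smul_add, Finset.smul_sum, smul_add, Finset.smul_sum, Finset.sum_sub_distrib]
    abel
  rw [e, show HeckeRing0.T M 2 q hq = ((HeckeRing0.primeTo.T M 2 (M * ℓ) hq hqS :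
      HeckeRing0.primeTo M 2 (M * ℓ)) : HeckeRing0 M 2) from rfl, hΛ _ _ (hmem r)]
  ring

end Mu

/-! ### §4 The assembly: (★★) on cycles ⟹ the certificate on paths -/

section Assembly

variable {M : ℕ} [NeZero M] {ℓ : ℕ} [Fact ℓ.Prime] {p : ℕ} [hp : Fact p.Prime]

/-- **(★★) ON CYCLES ⟹ THE LEVEL-LOWERING CERTIFICATE ON PATHS — no multiplicity one** (see the
module docstring for the data and the proof). The only non-numeral inputs are Ihara's lemma
`ribet1984_iharaLemma` (BY NAME) and the `ℓ`-old decomposition of `Ψ` on `H₁(X₀(Mℓ), ℤ)`.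
[cite: Ribet1984ICM, Thm. 4.1] [cite: RibetStein2001, Thm. 3.14 and Lemma 3.17]
[cite: Manin1972, Thm. 3.3 (20) and Thm. 3.5 (22)] [cite: MazurTateTeitelbaum1986Invent, §I.4 (4.2)] -/
theorem exists_sub_mul_of_oldOnCycles_of_ribet1984_iharaLemma (hI : ribet1984_iharaLemma)
    (hℓM : ¬ ℓ ∣ M) (hp2 : p ≠ 2) (θ : ℕ → ℤ) (hθℓ : ((θ ℓ : ℤ) : ZMod p) ^ 2 = 1)
    -- symbol functionals at the two levels
    (σ : ℚ → Module.Dual ℂ (CuspForm (Gamma0 (M * ℓ)) 2))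
    (hσ : ∀ (r : ℚ) (f : CuspForm (Gamma0 (M * ℓ)) 2), σ r f = modularSymbol f r)
    (σ' : ℚ → Module.Dual ℂ (CuspForm (Gamma0 M) 2))
    (hσ' : ∀ (r : ℚ) (f : CuspForm (Gamma0 M) 2), σ' r f = modularSymbol f r)
    -- the functional `Ψ` on `P ⊇ H₁(X₀(Mℓ), ℤ) ∪ {σ r}` carrying `φ`
    (P : AddSubgroup (Module.Dual ℂ (CuspForm (Gamma0 (M * ℓ)) 2)))
    (Ψ : Module.Dual ℂ (CuspForm (Gamma0 (M * ℓ)) 2) → ZMod p) (φ : ℚ → ZMod p)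
    (hσP : ∀ r : ℚ, σ r ∈ P) (hHP : periodHomology (M * ℓ) ≤ P)
    (hTP : ∀ (q : ℕ) (hq : q.Prime), ∀ z ∈ P, HeckeRing0.T (M * ℓ) 2 q hq • z ∈ P)
    (hΨadd : ∀ x ∈ P, ∀ y ∈ P, Ψ (x + y) = Ψ x + Ψ y) (hΨσ : ∀ r : ℚ, Ψ (σ r) = φ r)
    (hΨT : ∀ (q : ℕ) (hq : q.Prime), ∀ z ∈ P,
      Ψ (HeckeRing0.T (M * ℓ) 2 q hq • z) = ((θ q : ℤ) : ZMod p) * Ψ z)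
    -- (★★) `Ψ` is `ℓ`-old on cycles
    (Λ₁ Λ₂ : Module.Dual ℂ (CuspForm (Gamma0 M) 2) → ZMod p)
    (hadd₁ : ∀ x ∈ periodHomology M, ∀ y ∈ periodHomology M, Λ₁ (x + y) = Λ₁ x + Λ₁ y)
    (hadd₂ : ∀ x ∈ periodHomology M, ∀ y ∈ periodHomology M, Λ₂ (x + y) = Λ₂ x + Λ₂ y)
    (hold : ∀ z ∈ periodHomology (M * ℓ),
      Ψ z = Λ₁ ((degeneracyMap0 M (M * ℓ) 1 2).dualMap z) +
        Λ₂ ((degeneracyMap0 M (M * ℓ) ℓ 2).dualMap z))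
    -- the non-Eisenstein numeral
    {q₀ : ℕ} (hq₀ : q₀.Prime) (hq₀1 : q₀ ≡ 1 [MOD M * ℓ])
    (hθq₀ : ((θ q₀ : ℤ) : ZMod p) ≠ q₀ + 1) :
    ∃ μ : ℚ → ZMod p, IsPeriodic μ ∧
      (∀ q : ℕ, q.Prime → ¬ q ∣ M * ℓ → HeckeRel μ q ((θ q : ℤ) : ZMod p)) ∧
      ∀ r : ℚ, φ r = μ r - ((θ ℓ : ℤ) : ZMod p) * μ (ℓ * r) := by
  classical
  have hℓ : ℓ.Prime := Fact.out
  haveI : NeZero ℓ := ⟨hℓ.ne_zero⟩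
  haveI : NeZero q₀ := ⟨hq₀.ne_zero⟩
  have h1d : M * 1 ∣ M * ℓ := by rw [mul_one]; exact dvd_mul_right M ℓ
  have hℓd : M * ℓ ∣ M * ℓ := dvd_rfl
  have hq₀1M : q₀ ≡ 1 [MOD M] := hq₀1.of_mul_right ℓ
  have hq₀N : ¬ q₀ ∣ M * ℓ := by
    intro hd
    have h01 : 1 ≡ 0 [MOD q₀] :=
      ((hq₀1.of_dvd hd).symm.trans (Nat.modEq_zero_iff_dvd.mpr (dvd_refl q₀)))
    exact hq₀.one_lt.ne' (Nat.dvd_one.mp (Nat.modEq_zero_iff_dvd.mp h01))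
  -- the cycle defect `Y r = T_{q₀} • σ r − (q₀+1) • σ r ∈ H₁(X₀(Mℓ), ℤ)` and its value under `Ψ`
  have hY : ∀ r, HeckeRing0.T (M * ℓ) 2 q₀ hq₀ • σ r - ((q₀ + 1 : ℕ) : ℂ) • σ r ∈ periodHomology (M * ℓ) :=
    T_smul_sub_smul_symbol_mem_periodHomology (M * ℓ) σ hσ hq₀ hq₀1
  have hΨY : ∀ r, Ψ (HeckeRing0.T (M * ℓ) 2 q₀ hq₀ • σ r - ((q₀ + 1 : ℕ) : ℂ) • σ r) =
      (((θ q₀ : ℤ) : ZMod p) - (q₀ + 1)) * φ r := by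
    intro r
    rw [apply_sub_of_additiveOn Ψ hΨadd (hTP q₀ hq₀ _ (hσP r))
        (by rw [Nat.cast_smul_eq_nsmul]; exact P.nsmul_mem (hσP r) _),
      hΨT q₀ hq₀ _ (hσP r), apply_natCast_smul_of_additiveOn Ψ hΨadd (hσP r), hΨσ]
    push_cast
    ring
  have hcne : (((θ q₀ : ℤ) : ZMod p) - (q₀ + 1)) ≠ 0 := sub_ne_zero.mpr hθq₀
  -- `α_*`, `β_*` of the cycle defect are the level-`M` cycle defects at `r` and `ℓ r`
  have hαY : ∀ r, (degeneracyMap0 M (M * ℓ) 1 2).dualMap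
      (HeckeRing0.T (M * ℓ) 2 q₀ hq₀ • σ r - ((q₀ + 1 : ℕ) : ℂ) • σ r) =
      HeckeRing0.T M 2 q₀ hq₀ • σ' r - ((q₀ + 1 : ℕ) : ℂ) • σ' r := by
    intro r
    rw [map_sub, dualMap_degeneracyMap0_T_smul h1d hq₀ hq₀N, LinearMap.map_smul,
      dualMap_degeneracyMap0_symbol h1d σ hσ σ' hσ' r, Nat.cast_one, one_mul]
  have hβY : ∀ r, (degeneracyMap0 M (M * ℓ) ℓ 2).dualMap
      (HeckeRing0.T (M * ℓ) 2 q₀ hq₀ • σ r - ((q₀ + 1 : ℕ) : ℂ) • σ r) =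
      HeckeRing0.T M 2 q₀ hq₀ • σ' (ℓ * r) - ((q₀ + 1 : ℕ) : ℂ) • σ' (ℓ * r) := by
    intro r
    rw [map_sub, dualMap_degeneracyMap0_T_smul hℓd hq₀ hq₀N, LinearMap.map_smul,
      dualMap_degeneracyMap0_symbol hℓd σ hσ σ' hσ' r]
  -- the dichotomy
  have hΨT' : ∀ (r : ℕ) (hr : r.Prime), ¬ r ∣ M * ℓ → ∀ z ∈ periodHomology (M * ℓ),
      Ψ (HeckeRing0.T (M * ℓ) 2 r hr • z) = ((θ r : ℤ) : ZMod p) * Ψ z :=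
    fun r hr _ z hz ↦ hΨT r hr z (hHP hz)
  rcases apply_eq_zero_or_exists_ringHom_apply_T_eq (p := p) θ (ZMod.natCast_self p) Ψ Λ₁ Λ₂ hadd₁
      hadd₂ hΨT' hold with hzero | ⟨χ, hχ⟩
  · -- CASE 1: `Ψ = 0` on cycles ⟹ `φ = 0` on paths; `μ = 0`
    refine ⟨fun _ ↦ 0, fun _ _ ↦ rfl, fun q _ _ r ↦ by simp, fun r ↦ ?_⟩
    have h := hΨY r
    rw [hzero _ (hY r)] at h
    have hφ : φ r = 0 := (mul_eq_zero.mp h.symm).resolve_left hcne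
    rw [hφ, mul_zero, sub_zero]
  · -- CASE 2: `θ̄` is a character `χ` of the level-`M` Hecke ring
    have h𝔫 : (RingHom.ker χ).IsMaximal :=
      RingHom.ker_isMaximal_of_surjective χ (ZMod.ringHom_surjective χ)
    have h2 : (2 : ZMod p) ≠ 0 := by
      rw [show (2 : ZMod p) = ((2 : ℕ) : ZMod p) by norm_cast, Ne, ZMod.natCast_eq_zero_iff]
      exact fun h ↦ hp2 ((Nat.prime_dvd_prime_iff_eq hp.out Nat.prime_two).mp h)
    have hE : ¬ HeckeRing0.primeTo.IsEisenstein (RingHom.ker χ) := by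
      intro hEis
      have h := hEis q₀ hq₀ hq₀N hq₀1
      rw [RingHom.mem_ker, map_sub, hχ q₀ hq₀ hq₀N, map_add, map_natCast, map_one, sub_eq_zero] at h
      exact hθq₀ h
    have hΨTχ : ∀ (r : ℕ) (hr : r.Prime) (hrS : ¬ r ∣ M * ℓ), ∀ z ∈ periodHomology (M * ℓ),
        Ψ (HeckeRing0.T (M * ℓ) 2 r hr • z) = χ (HeckeRing0.primeTo.T M 2 (M * ℓ) hr hrS) * Ψ z :=
      fun r hr hrS z hz ↦ by rw [hχ r hr hrS]; exact hΨT r hr z (hHP hz)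
    have hΨaddH : ∀ x ∈ periodHomology (M * ℓ), ∀ y ∈ periodHomology (M * ℓ), Ψ (x + y) = Ψ x + Ψ y :=
      fun x hx y hy ↦ hΨadd x (hHP hx) y (hHP hy)
    -- Fitting projection: eigen components
    obtain ⟨Λ₁', Λ₂', hadd₁', hadd₂', hΛ₁', hΛ₂', hold'⟩ :=
      exists_eigenPair_of_oldPair_of_ribet1984_iharaLemma hI hℓM Ψ Λ₁ Λ₂ χ hadd₁ hadd₂ hΨaddH hΨTχ
        h𝔫 h2 hE hold
    -- the old shape is forced
    have hU : ∀ z ∈ periodHomology (M * ℓ),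
        Ψ ((heckeT (Gamma0 (M * ℓ)) 2 ℓ).dualMap z) = ((θ ℓ : ℤ) : ZMod p) * Ψ z := fun z hz ↦ by
      rw [dualMap_heckeT_eq_T_smul hℓ]; exact hΨT ℓ hℓ z (hHP hz)
    have hε : ((θ ℓ : ℤ) : ZMod p) * ((θ ℓ : ℤ) : ZMod p) = 1 := by rw [← sq, hθℓ]
    obtain ⟨-, -, hshape⟩ := oldShape_of_eigenPair_of_ribet1984_iharaLemma hI hℓM Ψ Λ₁' Λ₂' χ hΛ₁' hΛ₂'
      hadd₁' hadd₂' h𝔫 h2 hE hold' hε hU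
    -- the level-`M` function `μ`
    obtain ⟨μ, hμ⟩ : ∃ μ : ℚ → ZMod p, ∀ r, μ r = (((θ q₀ : ℤ) : ZMod p) - (q₀ + 1))⁻¹ *
        Λ₁' (HeckeRing0.T M 2 q₀ hq₀ • σ' r - ((q₀ + 1 : ℕ) : ℂ) • σ' r) := ⟨_, fun _ ↦ rfl⟩
    obtain ⟨hper, hH⟩ := isPeriodic_and_heckeRel_of_eigen Λ₁' χ hadd₁' hΛ₁' σ' hσ' hq₀ hq₀1M _ μ hμ
    refine ⟨μ, hper, fun q hq hqS ↦ ?_, fun r ↦ ?_⟩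
    · have hqM : ¬ q ∣ M := fun h ↦ hqS (h.mul_right ℓ)
      have h := hH q hq hqS hqM
      rwa [hχ q hq hqS] at h
    · -- transport the identity from cycles to paths
      have h := hΨY r
      rw [hshape _ (hY r), hαY, hβY] at h
      have hci : (((θ q₀ : ℤ) : ZMod p) - (q₀ + 1))⁻¹ * (((θ q₀ : ℤ) : ZMod p) - (q₀ + 1)) = 1 :=
        inv_mul_cancel₀ hcne
      rw [hμ, hμ]
      linear_combination -((((θ q₀ : ℤ) : ZMod p) - (q₀ + 1))⁻¹ * h) - φ r * hci

end Assembly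

end Summit.BirchSwinnertonDyer.Rank1Residual.LevelLowering

end
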